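import Summits.BirchSwinnertonDyer.BirchSwinnertonDyer.Theorems.AlignedTransportAtTwoBSDOfMainConjectureRankOneAtTwoEulerCharAtTwoCell
import Literature.NumberTheory.EllipticCurves.Greenberg1999.RankZeroEulerCharacteristicAnyPrime
import Literature.NumberTheory.EllipticCurves.PAdicBSDKatoFiniteProofs
import HarnessLib

/-!
# Route `AlignedTransportAtTwo`, crux C3′ `BSDOfMainConjectureRankOneAtTwo` (stmt-BirchSwinnertonDyer-23008), line `birth` v5/v6 —
# SCOPE CERTIFICATE: the rank-ZERO slice of the re-pointed residual (the `Γ`-Euler-characteristic formula at `2`) IS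
# Greenberg's Theorem 4.1 at `p = 2` (PRINT), in both directions

HONEST FRAMING (cell `bsd-f1-sign2`, WIDTH-5 attach seat `bsd-line-att-p4` g6 under the C3′ lead lineage `bsd-line-att-p1`;
`--supports stmt-BirchSwinnertonDyer-23008 --as helper`). BSD is NOT proved; C3′ is NOT closed (its cell is rank ONE; this file is about
rank ZERO and closes nothing there). THEOREMS ONLY (no `def`, no named fact, no `sorry`). Companion of `…AlignedTransportAtTwoEulerCharAtTwo`
(p624996: the open stub ⟺ the Euler-characteristic statement at `2`) and `…EulerCharAtTwoCell` (p625448).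

PURPOSE. The typed residual `F1Sign2.SchneiderLeadingTermFormulaAtTwoSq` carries a SCOPE NOTE for disprovers («the rank-ZERO slice of the
formula IS in print at every `p`, `2` included — Greenberg's Thm. 4.1 … so a counterexample must have `rank E(ℚ) ≥ 1`»). This file makes
that note a KERNEL THEOREM in the Euler-characteristic currency of p624996, and thereby CERTIFIES THE NORMALISATIONS of the re-pointed
residual (strict-at-`∞` dual, `2^{v₂(∏c_v)}`, `#Ẽ(𝔽₂)(2)²`, `#E(ℚ)(2)²`, `(log₂ 5)^r`, `Reg₂`) against the one printed `p = 2` statement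
there is — Greenberg, LNM 1716, Thm. 4.1 read at `p = 2` = the tree fact `Greenberg1999.thm41_charValue_rankZero_anyPrime` (PRINT; its
`p = 2` archimedean dictionary entry audited, flag `Gre99-Thm41-at-2-archimedean` closed, bsd-2adic audit-1 / referee R256.2):

* §1 `eulerCharAt_of_thm41_of_finite` — for `W` good ordinary at `2` with `E(ℚ)` FINITE (rank `0`): Thm. 4.1 at `2` ⟹ the
  Euler-characteristic statement for `W` (every cyclotomic datum, every f.g. torsion strict dual, every height datum — `Reg₂ = 1` in rank `0`,
  `padicRegulator_eq_one_of_finite`): `f_E(0) ≠ 0`, so `ord_T f_E = 0 = rank`, so `ker φ_X` is finite (p624996 §1); `f_E(0)·#ker φ_X ∼ #coker φ_X`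
  (tree); `#Sel_{2^∞}(E/ℚ) = #Ш(2)` (rank `0`); multiply out.
* §2 `thm41At_of_eulerCharAt_of_finite` — CONVERSELY (mod the Mazur–Tate `Σ²` series at `2`, `hMT`, only to inhabit the `IsCanonicalSq`
  binder of the residual): the Euler-characteristic statement for a rank-`0` `W` ⟹ Thm. 4.1's conclusion for `W`.
* §3 `schneiderLeadingTermFormulaAtTwoSqAt_of_thm41_of_finite` — hence the registered stub's per-curve form HOLDS for every rank-`0` curve
  modulo PRINT (Thm. 4.1 at `2`): disprovers of `stub_leadingTermFormulaAtTwo` / of the v6 Euler-characteristic stub must use `rank ≥ 1`.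

References: [GreenbergLNM1716] Thm. 4.1, Lemma 4.2; [CoatesSchneiderSujatha2003] p. 203 (Case 1), §3 (30)–(31); [MazurTateTeitelbaum1986Invent]
§II.4 (empty regulator `= 1`).
-/

set_option autoImplicit false
-- the route's Theorems namespace repeats a component by design (summit = sub-problem, D-0017).
set_option linter.dupNamespace false

noncomputable section

open scoped Classical

open WeierstrassCurve Literature.NumberTheory.EllipticCurves Literature.NumberTheory.EllipticCurves.IwasawaAlgebra
  Literature.NumberTheory.EllipticCurves.Greenberg1999 Summit.BirchSwinnertonDyer.Rank1Residual.F1Sign2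
  Summit.BirchSwinnertonDyer.BirchSwinnertonDyer.Theorems.AlignedTransportAtTwoEulerCharAtTwo

namespace Summit.BirchSwinnertonDyer.BirchSwinnertonDyer.Theorems.AlignedTransportAtTwoEulerCharAtTwoRankZero

/-! ## §1 Rank `0`: Greenberg's Thm. 4.1 at `2` ⟹ the `Γ`-Euler-characteristic statement -/

/-- **Rank-`0` slice, PRINT ⟹ residual (CONDITIONAL on Thm. 4.1 at `2`; closes nothing on the rank-one cell).** For `W/ℚ` globally minimal,
good ordinary at `2`, with `E(ℚ)` finite: Greenberg's Thm. 4.1 at `p = 2` (`thm41_charValue_rankZero_anyPrime`: `f_E(0)·#E(ℚ)(2)² =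
u·2^{v₂(∏c_v)}·#Ẽ(𝔽₂)(2)²·#Sel_{2^∞}(E/ℚ)` whenever `Sel_{2^∞}(E/ℚ)` is finite) implies, for every cyclotomic datum, every finitely generated
torsion strict-at-`∞` dual `X = D.X` and every `2`-adic height datum `Dh`, given `Ш(E/ℚ)(2)` finite: `ker φ_X` is finite and
`#coker φ_X·(log₂ 5)^0·#E(ℚ)(2)² = u′·#ker φ_X·Reg₂(Dh)·#Ш(2)·2^{v₂(∏c_v)}·#Ẽ(𝔽₂)(2)²` — the Euler-characteristic statement of p624996 for `W`
(`Reg₂(Dh) = 1`, `padicRegulator_eq_one_of_finite`; `#Sel_{2^∞}(E/ℚ) = #Ш(2)`, `natCard_selmerGroupPInfty_eq_natCard_primaryComponent_sha`;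
`f_E(0) ≠ 0 ⟹ ord f_E = 0 = rank ⟹ ker φ_X` finite, `order_eq_mordellWeilRank_iff_finite_ker_bockstein`; `f_E(0)·#ker φ_X ∼ #coker φ_X`,
`coeff_charGenerator_mul_card_ker_bockstein_of_order_eq`). The binders `IsCyclotomicVariable`, `IsCanonicalSq`, `SchneiderConjecture` of the
residual are carried and unused. [cite: GreenbergLNM1716, Thm. 4.1 and Lemma 4.2] [cite: CoatesSchneiderSujatha2003, p. 203 (Case 1)] -/
theorem eulerCharAt_of_thm41_of_finite (h41 : thm41_charValue_rankZero_anyPrime)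
    (W : WeierstrassCurve ℚ) [W.IsElliptic] [W.IsGloballyMinimal] [Finite W.toAffine.Point] :
    W.HasGoodReductionAtPrime 2 → ¬ (2 : ℤ) ∣ W.frobeniusTrace 2 →
      ∀ (κ : ZpExtension ℚ 2) (γ : Field.absoluteGaloisGroup ℚ),
        κ.IsCyclotomic → κ.IsTopGenerator γ → IsCyclotomicVariable 2 γ →
      ∀ (D : W.SelmerDualData κ γ) [Module.Finite (IwasawaAlgebra 2) D.X], D.IsTorsion →
      ∀ (Dh : PAdicHeightData W 2), Dh.IsCanonicalSq →
        SchneiderConjecture Dh → Finite (AddCommGroup.primaryComponent W.sha 2) →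
        Finite (LinearMap.ker (bockstein 2 D.X)) ∧
        ∃ u : ℤ_[2]ˣ,
          (Nat.card (coinvariants 2 D.X ⧸ LinearMap.range (bockstein 2 D.X)) : ℚ_[2]) *
              padicLog 2 (cyclotomicGenerator 2) ^ W.mordellWeilRank *
              (Nat.card (AddCommGroup.primaryComponent W.toAffine.Point 2) : ℚ_[2]) ^ 2 =
            ((u : ℤ_[2]) : ℚ_[2]) * Nat.card (LinearMap.ker (bockstein 2 D.X)) * padicRegulator Dh *
              Nat.card (AddCommGroup.primaryComponent W.sha 2) * (2 : ℚ_[2]) ^ (padicValNat 2 W.tamagawaProduct) *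
              (Nat.card (AddCommGroup.primaryComponent
                ((integralModelInt W).map (Int.castRingHom (ZMod 2))).toAffine.Point 2) : ℚ_[2]) ^ 2 := by
  intro hg ho κ γ hκ hγ hγ' D _ hX Dh _ _ hSha
  haveI : NeZero (2 : ℕ) := ⟨two_ne_zero⟩
  have hr : W.mordellWeilRank = 0 := W.mordellWeilRank_eq_zero_iff_finite.mpr ‹_›
  have hReg : padicRegulator Dh = 1 := padicRegulator_eq_one_of_finite W 2 Dh
  haveI : Finite (AddCommGroup.primaryComponent W.sha 2) := hSha
  have hSel : Finite (W.selmerGroupPInfty 2) := W.finite_selmerGroupPInfty_of_finite_primaryComponent 2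
  have hcardSel : Nat.card (W.selmerGroupPInfty 2) = Nat.card (AddCommGroup.primaryComponent W.sha 2) :=
    W.natCard_selmerGroupPInfty_eq_natCard_primaryComponent_sha 2
  -- a characteristic generator and Thm. 4.1 at `2`
  obtain ⟨fE, hchar⟩ := (charIdeal_isPrincipal_holds 2 D.X).principal
  obtain ⟨u, hu⟩ := h41 W 2 hg ho κ γ hκ hγ hγ' D hX fE hchar hSel
  -- `f_E(0) ≠ 0`, so `ord f_E = 0 = rank` and `ker φ_X` is finite
  have hNp0 : (Nat.card (AddCommGroup.primaryComponent
      ((integralModelInt W).map (Int.castRingHom (ZMod 2))).toAffine.Point 2) : ℚ_[2]) ≠ 0 := by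
    haveI : Finite ((integralModelInt W).map (Int.castRingHom (ZMod 2))).toAffine.Point :=
      Nat.finite_of_card_ne_zero (W.reductionPointCount_pos 2).ne'
    exact_mod_cast Nat.card_pos.ne'
  have hSel0 : (Nat.card (W.selmerGroupPInfty 2) : ℚ_[2]) ≠ 0 := by exact_mod_cast Nat.card_pos.ne'
  have hf0 : PowerSeries.constantCoeff fE ≠ 0 := by
    intro h0
    have h := hu
    rw [h0] at h
    simp only [PadicInt.coe_zero, zero_mul] at h
    exact (mul_ne_zero (mul_ne_zero (mul_ne_zero (coe_units_ne_zero 2 u) (pow_ne_zero _ two_ne_zero))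
      (pow_ne_zero 2 hNp0)) hSel0) h.symm
  have heq : fE.order = W.mordellWeilRank := by
    have hc : PowerSeries.coeff W.mordellWeilRank fE ≠ 0 := by
      rw [hr, PowerSeries.coeff_zero_eq_constantCoeff_apply]; exact hf0
    exact (order_eq_mordellWeilRank_iff_coeff_ne_zero W hγ D hX fE hchar).mpr hc
  have hfin : Finite (LinearMap.ker (bockstein 2 D.X)) :=
    (order_eq_mordellWeilRank_iff_finite_ker_bockstein W 2 ⟨hg, ho⟩ hκ hγ D hX fE hchar hSha).mp heq
  refine ⟨hfin, ?_⟩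
  -- `f_E(0)·#ker φ_X = u₁·#coker φ_X`
  obtain ⟨u₁, hu₁⟩ := coeff_charGenerator_mul_card_ker_bockstein_of_order_eq 2 D.X hX fE hchar (n := 0)
    (by rw [heq, hr]) hfin
  rw [PowerSeries.coeff_zero_eq_constantCoeff_apply] at hu₁
  -- abbreviations
  set c : ℚ_[2] := ((PowerSeries.constantCoeff fE : ℤ_[2]) : ℚ_[2]) with hc
  set Kk : ℚ_[2] := (Nat.card (LinearMap.ker (bockstein 2 D.X)) : ℚ_[2]) with hK
  set C : ℚ_[2] := (Nat.card (coinvariants 2 D.X ⧸ LinearMap.range (bockstein 2 D.X)) : ℚ_[2]) with hC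
  set Tp : ℚ_[2] := (Nat.card (AddCommGroup.primaryComponent W.toAffine.Point 2) : ℚ_[2]) with hTp
  set Np : ℚ_[2] := (Nat.card (AddCommGroup.primaryComponent
    ((integralModelInt W).map (Int.castRingHom (ZMod 2))).toAffine.Point 2) : ℚ_[2]) with hNp
  set Sh : ℚ_[2] := (Nat.card (AddCommGroup.primaryComponent W.sha 2) : ℚ_[2]) with hSh
  set v := padicValNat 2 W.tamagawaProduct with hv
  have H1 : c * Kk = ((u₁ : ℤ_[2]) : ℚ_[2]) * C := by
    have := congrArg ((↑) : ℤ_[2] → ℚ_[2]) hu₁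
    push_cast at this
    rw [hc, hK, hC]
    exact_mod_cast this
  -- Thm. 4.1 in the abbreviations: `c·Tp² = u·2^v·Np²·Sh`
  have H41 : c * Tp ^ 2 = ((u : ℤ_[2]) : ℚ_[2]) * (2 : ℚ_[2]) ^ v * Np ^ 2 * Sh := by
    rw [hc, hTp, hNp, hSh, hv, ← hcardSel]; exact_mod_cast hu
  have hu₁0 : ((u₁ : ℤ_[2]) : ℚ_[2]) ≠ 0 := coe_units_ne_zero 2 u₁
  -- the unit `u′ = u·u₁⁻¹`
  set U : ℤ_[2]ˣ := u * u₁⁻¹ with hU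
  have hUval : ((U : ℤ_[2]) : ℚ_[2]) * ((u₁ : ℤ_[2]) : ℚ_[2]) = ((u : ℤ_[2]) : ℚ_[2]) := by
    have h : (((U * u₁ : ℤ_[2]ˣ) : ℤ_[2]) : ℚ_[2]) = (((u : ℤ_[2]ˣ) : ℤ_[2]) : ℚ_[2]) := by
      rw [hU, inv_mul_cancel_right]
    simpa [Units.val_mul] using h
  refine ⟨U, ?_⟩
  rw [hr, pow_zero, mul_one, hReg, mul_one]
  apply mul_right_cancel₀ hu₁0
  calc C * Tp ^ 2 * ((u₁ : ℤ_[2]) : ℚ_[2]) = (((u₁ : ℤ_[2]) : ℚ_[2]) * C) * Tp ^ 2 := by ring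
    _ = c * Kk * Tp ^ 2 := by rw [← H1]
    _ = Kk * (c * Tp ^ 2) := by ring
    _ = Kk * (((u : ℤ_[2]) : ℚ_[2]) * (2 : ℚ_[2]) ^ v * Np ^ 2 * Sh) := by rw [H41]
    _ = (((U : ℤ_[2]) : ℚ_[2]) * ((u₁ : ℤ_[2]) : ℚ_[2])) * Kk * Sh * (2 : ℚ_[2]) ^ v * Np ^ 2 := by rw [hUval]; ring
    _ = ((U : ℤ_[2]) : ℚ_[2]) * Kk * Sh * (2 : ℚ_[2]) ^ v * Np ^ 2 * ((u₁ : ℤ_[2]) : ℚ_[2]) := by ring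

/-! ## §2 Rank `0`: the `Γ`-Euler-characteristic statement ⟹ Greenberg's Thm. 4.1 conclusion (mod `Σ²` at `2`) -/

/-- **Rank-`0` slice, residual ⟹ PRINT's conclusion (CONDITIONAL on `hMT`, only to inhabit the `Σ²` binder; closes nothing).** For `W/ℚ` globally
minimal, good ordinary at `2`, with `E(ℚ)` finite: IF the Euler-characteristic statement of p624996 holds for `W`, THEN for every cyclotomic
datum, every finitely generated torsion strict dual `X` with `char X = (f_E)` and `Sel_{2^∞}(E/ℚ)` finite,
`f_E(0)·#E(ℚ)(2)² = u·2^{v₂(∏c_v)}·#Ẽ(𝔽₂)(2)²·#Sel_{2^∞}(E/ℚ)` — Thm. 4.1's conclusion at `2` for this `W`. (THE canonical `Σ²` height exists by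
`exists_isCanonicalSq_two hMT`, its regulator is `1` in rank `0`, so the residual applies; `ker φ_X` finite ⟹ `ord f_E = 0`;
`f_E(0)·#ker φ_X ∼ #coker φ_X`; `#Ш(2) = #Sel_{2^∞}(E/ℚ)`.) So on rank-`0` curves the residual says EXACTLY what Thm. 4.1 says.
[cite: GreenbergLNM1716, Thm. 4.1 and Lemma 4.2] [cite: MazurTate1991, Thm. 3.1] -/
theorem thm41At_of_eulerCharAt_of_finite (hMT : mazurTate_sigmaSq_existsUnique_two)
    (W : WeierstrassCurve ℚ) [W.IsElliptic] [W.IsGloballyMinimal] [Finite W.toAffine.Point]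
    (hχ : W.HasGoodReductionAtPrime 2 → ¬ (2 : ℤ) ∣ W.frobeniusTrace 2 →
      ∀ (κ : ZpExtension ℚ 2) (γ : Field.absoluteGaloisGroup ℚ),
        κ.IsCyclotomic → κ.IsTopGenerator γ → IsCyclotomicVariable 2 γ →
      ∀ (D : W.SelmerDualData κ γ) [Module.Finite (IwasawaAlgebra 2) D.X], D.IsTorsion →
      ∀ (Dh : PAdicHeightData W 2), Dh.IsCanonicalSq →
        SchneiderConjecture Dh → Finite (AddCommGroup.primaryComponent W.sha 2) →
        Finite (LinearMap.ker (bockstein 2 D.X)) ∧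
        ∃ u : ℤ_[2]ˣ,
          (Nat.card (coinvariants 2 D.X ⧸ LinearMap.range (bockstein 2 D.X)) : ℚ_[2]) *
              padicLog 2 (cyclotomicGenerator 2) ^ W.mordellWeilRank *
              (Nat.card (AddCommGroup.primaryComponent W.toAffine.Point 2) : ℚ_[2]) ^ 2 =
            ((u : ℤ_[2]) : ℚ_[2]) * Nat.card (LinearMap.ker (bockstein 2 D.X)) * padicRegulator Dh *
              Nat.card (AddCommGroup.primaryComponent W.sha 2) * (2 : ℚ_[2]) ^ (padicValNat 2 W.tamagawaProduct) *
              (Nat.card (AddCommGroup.primaryComponent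
                ((integralModelInt W).map (Int.castRingHom (ZMod 2))).toAffine.Point 2) : ℚ_[2]) ^ 2)
    (hg : W.HasGoodReductionAtPrime 2) (ho : ¬ (2 : ℤ) ∣ W.frobeniusTrace 2)
    {κ : ZpExtension ℚ 2} {γ : Field.absoluteGaloisGroup ℚ}
    (hκ : κ.IsCyclotomic) (hγ : κ.IsTopGenerator γ) (hγ' : IsCyclotomicVariable 2 γ)
    (D : W.SelmerDualData κ γ) [Module.Finite (IwasawaAlgebra 2) D.X] (hX : D.IsTorsion)
    (fE : IwasawaAlgebra 2) (hchar : D.charIdeal = Ideal.span {fE}) (hSel : Finite (W.selmerGroupPInfty 2)) :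
    ∃ u : ℤ_[2]ˣ,
      ((PowerSeries.constantCoeff fE : ℤ_[2]) : ℚ_[2]) *
          (Nat.card (AddCommGroup.primaryComponent W.toAffine.Point 2) : ℚ_[2]) ^ 2 =
        ((u : ℤ_[2]) : ℚ_[2]) * (2 : ℚ_[2]) ^ (padicValNat 2 W.tamagawaProduct) *
          (Nat.card (AddCommGroup.primaryComponent
            ((integralModelInt W).map (Int.castRingHom (ZMod 2))).toAffine.Point 2) : ℚ_[2]) ^ 2 *
          (Nat.card (W.selmerGroupPInfty 2) : ℚ_[2]) := by
  have hr : W.mordellWeilRank = 0 := W.mordellWeilRank_eq_zero_iff_finite.mpr ‹_›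
  have hSha : Finite (AddCommGroup.primaryComponent W.sha 2) := ((W.finite_selmerGroupPInfty_iff 2).mp hSel).2
  have hcardSel : Nat.card (W.selmerGroupPInfty 2) = Nat.card (AddCommGroup.primaryComponent W.sha 2) :=
    W.natCard_selmerGroupPInfty_eq_natCard_primaryComponent_sha 2
  -- THE canonical `Σ²` height; its regulator is `1`
  obtain ⟨Dh, hDh⟩ := exists_isCanonicalSq_two hMT W hg ho
  have hReg : padicRegulator Dh = 1 := padicRegulator_eq_one_of_finite W 2 Dh
  have hS : SchneiderConjecture Dh := by rw [SchneiderConjecture, hReg]; exact one_ne_zero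
  obtain ⟨hfin, u, hu⟩ := hχ hg ho κ γ hκ hγ hγ' D hX Dh hDh hS hSha
  -- `ord f_E = 0`
  have heq : fE.order = W.mordellWeilRank :=
    (order_eq_mordellWeilRank_iff_finite_ker_bockstein W 2 ⟨hg, ho⟩ hκ hγ D hX fE hchar hSha).mpr hfin
  obtain ⟨u₁, hu₁⟩ := coeff_charGenerator_mul_card_ker_bockstein_of_order_eq 2 D.X hX fE hchar (n := 0)
    (by rw [heq, hr]) hfin
  rw [PowerSeries.coeff_zero_eq_constantCoeff_apply] at hu₁
  -- abbreviations
  set c : ℚ_[2] := ((PowerSeries.constantCoeff fE : ℤ_[2]) : ℚ_[2]) with hc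
  set Kk : ℚ_[2] := (Nat.card (LinearMap.ker (bockstein 2 D.X)) : ℚ_[2]) with hK
  set C : ℚ_[2] := (Nat.card (coinvariants 2 D.X ⧸ LinearMap.range (bockstein 2 D.X)) : ℚ_[2]) with hC
  set Tp : ℚ_[2] := (Nat.card (AddCommGroup.primaryComponent W.toAffine.Point 2) : ℚ_[2]) with hTp
  set Np : ℚ_[2] := (Nat.card (AddCommGroup.primaryComponent
    ((integralModelInt W).map (Int.castRingHom (ZMod 2))).toAffine.Point 2) : ℚ_[2]) with hNp
  set Sh : ℚ_[2] := (Nat.card (AddCommGroup.primaryComponent W.sha 2) : ℚ_[2]) with hSh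
  set v := padicValNat 2 W.tamagawaProduct with hv
  have H1 : c * Kk = ((u₁ : ℤ_[2]) : ℚ_[2]) * C := by
    have := congrArg ((↑) : ℤ_[2] → ℚ_[2]) hu₁
    push_cast at this
    rw [hc, hK, hC]
    exact_mod_cast this
  -- the residual in the abbreviations: `C·Tp² = u·K·Sh·2^v·Np²`
  have Hχ : C * Tp ^ 2 = ((u : ℤ_[2]) : ℚ_[2]) * Kk * Sh * (2 : ℚ_[2]) ^ v * Np ^ 2 := by
    have h := hu
    rw [hr, pow_zero, mul_one, hReg, mul_one] at h
    rw [hC, hTp, hK, hSh, hv, hNp]; exact h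
  have hK0 : Kk ≠ 0 := by
    haveI := hfin
    rw [hK]; exact_mod_cast Nat.card_pos.ne'
  refine ⟨u * u₁, ?_⟩
  rw [hcardSel]
  apply mul_right_cancel₀ hK0
  calc c * Tp ^ 2 * Kk = (c * Kk) * Tp ^ 2 := by ring
    _ = ((u₁ : ℤ_[2]) : ℚ_[2]) * (C * Tp ^ 2) := by rw [H1]; ring
    _ = ((u₁ : ℤ_[2]) : ℚ_[2]) * (((u : ℤ_[2]) : ℚ_[2]) * Kk * Sh * (2 : ℚ_[2]) ^ v * Np ^ 2) := by rw [Hχ]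
    _ = (((u * u₁ : ℤ_[2]ˣ) : ℤ_[2]) : ℚ_[2]) * (2 : ℚ_[2]) ^ v * Np ^ 2 * Sh * Kk := by push_cast; ring

/-! ## §3 Rank `0`: the registered stub's per-curve form holds modulo PRINT -/

/-- **The rank-`0` slice of `stub_leadingTermFormulaAtTwo` is PRINT (CONDITIONAL on Thm. 4.1 at `2`; closes nothing on the rank-one cell).**
For `W/ℚ` globally minimal with `E(ℚ)` finite, Greenberg's Thm. 4.1 at `2` implies `SchneiderLeadingTermFormulaAtTwoSqAt W` (the registered
open stub of C3′ read at `W`): §1 composed with p624996's `schneiderLeadingTermFormulaAtTwoSqAt_iff_eulerCharAt`. Kernel form of the SCOPE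
NOTE in the residual's docstring: a counterexample to the stub (v5) or to its Euler-characteristic form (v6) needs `rank E(ℚ) ≥ 1`.
[cite: GreenbergLNM1716, Thm. 4.1] [cite: BalakrishnanMullerStein2015, Thm. 1.7 (3)] -/
theorem schneiderLeadingTermFormulaAtTwoSqAt_of_thm41_of_finite (h41 : thm41_charValue_rankZero_anyPrime)
    (W : WeierstrassCurve ℚ) [W.IsElliptic] [W.IsGloballyMinimal] [Finite W.toAffine.Point] :
    SchneiderLeadingTermFormulaAtTwoSqAt W :=
  (schneiderLeadingTermFormulaAtTwoSqAt_iff_eulerCharAt W).mpr (eulerCharAt_of_thm41_of_finite h41 W)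

end Summit.BirchSwinnertonDyer.BirchSwinnertonDyer.Theorems.AlignedTransportAtTwoEulerCharAtTwoRankZero

end
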